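import Summits.BirchSwinnertonDyer.BirchSwinnertonDyer.Theorems.VerticalContactPGSelmerBSDStubKatoBoundOfItem
import Summits.BirchSwinnertonDyer.BirchSwinnertonDyer.Theses.SelmerRank
import Literature.NumberTheory.EllipticCurves.BSDSelmerParityDokchitserProofs
import HarnessLib

/-!
# BirchSwinnertonDyer / VerticalContact — crux `PGSelmerBSD` (stmt-BirchSwinnertonDyer-17810), line `Sketch`:
# the crux from the transfer target C⁺ and THREE SIBLING ITEMS by name (glue for a planner's split)

Companion of `VerticalContactPGSelmerBSDOfFreeOrderMinimalPrime` (transfer theorem of line `Sketch`, Kato's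
bound entering as the ∀-closure of the Literature fact). Here Kato enters BY NAME as the shared route item
`LeadingTerm.KatoDivisibility` (stmt-BirchSwinnertonDyer-18082), through the landed rewiring
`stub_katoBound_of_katoDivisibility`, so that the crux reads

  GZK (bsd.S17, fact) → modularity (fact) → KatoDivisibility (item 18082) → C⁺ → SelmerRankLB (item 0131)
    → SelmerRankCM (item 18086) → PGSelmerBSD,

with C⁺ = the registered stub `stub_freeOrderMinimalPrime` verbatim (one admissible prime with
`ord_{T=0} L_p ≤ r_an` for every non-CM sector curve of analytic rank `≥ 2`). This is the `--glue-by` shape for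
a split of `PGSelmerBSD` into {C⁺ (to be filed), 18082, 0131, 18086} modulo the two literature facts.
Cells as in the transfer theorem: `r_an ≤ 1` by GZK at any prime; CM by the CM item at a good ordinary prime
(`exists_good_ordinary_prime_holds`); non-CM `r_an ≥ 2` at the prime of C⁺ (`corank_p ≤ ord_T L_p ≤ r_an`,
newform from modularity with `NeZero N_E` from `conductorNorm_pos_holds`; `r_an ≤ corank_p` from the LB item).
-/

set_option linter.dupNamespace false

open scoped MatrixGroups ModularForm

open CongruenceSubgroup Literature.NumberTheory.EllipticCurves.ModularForms

namespace Summit.BirchSwinnertonDyer.BirchSwinnertonDyer.Theorems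

open Summit.BirchSwinnertonDyer.BirchSwinnertonDyer.Theses
open Literature.NumberTheory.EllipticCurves

/-- **Line `Sketch`, crux `PGSelmerBSD`: the crux from C⁺ and the items `KatoDivisibility` (18082),
`SelmerRankLB` (0131), `SelmerRankCM` (18086) by name, modulo Gross–Zagier–Kolyvagin (bsd.S17) and
modularity (BCDT Thm A) as named facts.** Glue shape for a planner's split of the crux. CONDITIONAL on the
two facts; C⁺ and the three items are open. [cite: Kato2004Asterisque, Thm. 17.4 (p. 273) and Thm. 18.4 (p. 281)] -/
theorem pgSelmerBSD_of_freeOrderMinimalPrime_of_items : Literature.NumberTheory.EllipticCurves.rank_eq_analyticRank_of_analyticRank_le_one → Literature.NumberTheory.EllipticCurves.ModularForms.exists_isNewformOf → Summit.BirchSwinnertonDyer.BirchSwinnertonDyer.Theses.LeadingTerm.KatoDivisibility → (∀ (W : WeierstrassCurve ℚ) [W.IsElliptic] [W.IsGloballyMinimal], (¬ ∃ (q : ℕ) (_ : Fact q.Prime), W.HasMultiplicativeReductionAtPrime q) → ¬ W.HasCM → 2 ≤ W.analyticRank → ∃ (p : ℕ) (_ : Fact p.Prime), (5 ≤ p ∧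 W.HasGoodReductionAtPrime p ∧ ¬ (p : ℤ) ∣ W.frobeniusTrace p ∧ W.HasSurjectiveModNGaloisRep p) ∧ ∀ {N : ℕ} [NeZero N] (f : CuspForm (Gamma0 N) 2), IsNewformOf W f → (padicLFunction f (unitRoot W p : ℚ_[p])).order ≤ W.analyticRank) → Summit.BirchSwinnertonDyer.BirchSwinnertonDyer.Theses.VerticalContact.SelmerRankLB → Summit.BirchSwinnertonDyer.BirchSwinnertonDyer.Theses.SelmerRank.SelmerRankCM → Summit.BirchSwinnertonDyer.BirchSwinnertonDyer.Theses.VerticalContact.PGSelmerBSD := by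
  intro hGZK hmod hK hC hLB hCM W _ _ hsec
  by_cases hr : W.analyticRank ≤ 1
  · exact ⟨2, ⟨Nat.prime_two⟩, selmerCorank_eq_analyticRank_of_analyticRank_le_one hGZK W 2 hr⟩
  by_cases hW : W.HasCM
  · obtain ⟨p, hp, h5, hgood, hord⟩ := WeierstrassCurve.exists_good_ordinary_prime_holds W
    exact ⟨p, hp, hCM W p h5 hgood hord hW⟩
  · obtain ⟨p, hp, ⟨h5, hgood, hord, hsurj⟩, hCp⟩ := hC W hsec hW (by omega)
    haveI : NeZero (W.conductorNorm ℤ) := ⟨(W.conductorNorm_pos_holds).ne'⟩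
    obtain ⟨f, hf⟩ := hmod W
    have hub : (W.selmerCorank p : ℕ∞) ≤ (W.analyticRank : ℕ∞) :=
      (stub_katoBound_of_katoDivisibility hK W p h5 hgood hord hsurj (by omega) f hf).trans (hCp f hf)
    exact ⟨p, hp, le_antisymm (by exact_mod_cast hub) (hLB W p h5 hgood hord hsurj)⟩

end Summit.BirchSwinnertonDyer.BirchSwinnertonDyer.Theorems
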